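import Literature.Probability.RandomPlanarGeometry.SLEScaleInvariance
import Literature.Probability.Process.KolmogorovExtensionProofs
import HarnessLib

/-!
# Transience of the SLE trace (Rohde–Schramm, Thm. 7.1): decomposition and the scaling step

Trunk T-STOCH. The named fact `Literature.Probability.RandomPlanarGeometry.tendsto_norm_sleTrace_atTop`
(`Literature/Probability/RandomPlanarGeometry/SLE.lean`: for `κ > 0`, almost surely
`|γ(t)| → ∞` as `t → ∞`, `γ = sleTrace κ ω` the chordal SLE_κ trace; S. Rohde, O. Schramm,
*Basic properties of SLE*, Ann. of Math. 161 (2005), Thm. 7.1, with the Update on p. 911 for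
`κ = 8`) is decomposed here along the printed proof (§7, pp. 909–911), and its last step is
**proved**.

**Printed statement** (p. 909). "Theorem 7.1 (Transience). For all `κ ≠ 8` the SLE_κ trace
`γ(t)` is transient a.s. That is, `P[liminf_{t→∞} |γ(t)| = ∞] = 1`." And (p. 911): "Update.
Corollary 7.4 and Theorem 7.1 are true also for `κ = 8`. The proofs are based on the extension
[LSW] to `κ = 8` of Theorem 5.1, and are otherwise the same."

**Printed proof** (p. 911). "First suppose that `κ > 4`. Then we know from Lemma 7.3 that there
is a random but positive `r > 0` such that `K₁ ⊃ {z ∈ ℍ : |z| < r}`. Let `ε > 0`, and let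
`r₀ = r₀(κ, ε) > 0` be a constant such that `P[r < r₀] < ε`. Then the scaling property of SLE
shows that for all `t > 0`, `P[Kₜ ⊃ {z ∈ ℍ : |z| < r₀ √t}] ≥ 1 - ε`. This implies that
`P[∃ t' > t : |γ(t')| < r₀ √t] < ε`. Since `ε > 0` was arbitrary, this clearly implies
transience. Consider now the case `κ ∈ [0, 4]`. In this range, `γ` is a simple path. Then a.s.
there are two limit points `x₀, x₁` for `g₁(z)` as `z → 0` in `H₁`. Note that `g₁(γ[1, ∞))` has
the same distribution as `γ[0, ∞)` translated by `ξ(1)`. Consequently, Lemma 7.2 shows that a.s.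
`x₀` and `x₁` are not in the closure of `g₁(γ[1, ∞))`. This means that `0 ∉ cl γ[1, ∞)` a.s.
The proof is then completed as in the case `κ > 4` above."

**What is vendored (named facts, `def … : Prop`, faithful to the printed scope).**

* `Literature.Probability.RandomPlanarGeometry.RohdeSchramm2005_lem72` — **Lemma 7.2** (p. 909): `κ ≤ 4`, `x ∈ ℝ ∖ {0}` ⇒ a.s.
  `x ∉ cl γ[0, ∞)` (Bessel-flow hitting probabilities of Lemma 6.2; for `κ = 4` Schwarz
  reflection, Koebe 1/4 and an Itô computation with the dilogarithm). Not consumed here; it is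
  the leaf under the next item.
* `Literature.Probability.RandomPlanarGeometry.RohdeSchramm2005_thm71_simpleStep` — the conclusion of the case `κ ∈ [0, 4]` of the
  printed proof up to the sentence "This means that `0 ∉ cl γ[1, ∞)` a.s." (p. 911), stated for
  the SLE_κ path `γ` given that it exists (hypothesis `HasSLETrace κ`, Thm. 5.1, as in the source,
  where `γ` is that path; see the docstring for why the hypothesis is explicit): its inputs are
  Thm. 6.1 (simple path), the two prime ends of `H₁` at `0`, the conformal Markov property of SLE
  at time `1`, and Lemma 7.2.
* `Literature.Probability.RandomPlanarGeometry.RohdeSchramm2005_lem73` — **Lemma 7.3** (p. 910): `κ > 4`, `κ ≠ 8`, `t > 0` ⇒ a.s.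
  `Kₜ ⊇ {z ∈ ℍ : |z| < ε}` for some `ε > 0` (Thm. 5.1, Lemma 6.6, conformal Markov property,
  scaling, Blumenthal's 0-1 law; for `κ > 8` also Thm. 6.4, Lemma 6.5, Cor. 5.3).
* `Literature.Probability.RandomPlanarGeometry.RohdeSchramm2005_thm71_eight` — Theorem 7.1 for `κ = 8`, as asserted by the Update
  (p. 911) "based on the extension [LSW] to `κ = 8` of Theorem 5.1": stated as an implication
  from that extension (`HasSLETrace 8`, the named fact `hasSLETrace_eight`, Lawler–Schramm–Werner
  (2004), Thm. 4.7) so that [LSW] is not vendored twice. (Lemma 7.3 is printed for `κ ≠ 8` only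
  and its `κ ∈ (4, 8)` branch uses Lemma 6.6, stated for `κ ∈ (4, 8)`; we do not extrapolate an
  unprinted `κ = 8` version of Lemma 7.3, and keep the `κ = 8` case as the sentence the source
  prints.)

**What is proved.**

* `Literature.Probability.RandomPlanarGeometry.Loewner.IsGeneratedByCurve.le_norm_of_subset_hull` — deterministic: if
  `{z ∈ ℍ : |z| < ε} ⊆ Kₜ` then `|γ(s)| ≥ ε` for all `s ≥ t` (the curve stays in `cl Hₜ` after
  time `t`, `IsGeneratedByCurve.mem_closure_domain`); hence Lemma 7.3 gives
  `0 ∉ cl γ[1, ∞)` a.s. for `4 < κ ≠ 8` (`Literature.Probability.RandomPlanarGeometry.ae_zero_notMem_closure_sleTrace_of_lem73`).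
* `Literature.Probability.RandomPlanarGeometry.tendsto_norm_sleTrace_atTop_of_notMem_closure` — **the scaling step** ("the proof is
  then completed as in the case `κ > 4`"): for any `κ` with a trace (`HasSLETrace κ`) whose trace
  is scale invariant in law (hypothesis `hscale`: `γ ~ c γ(·/c²)` on the path space; this is
  Rohde–Schramm Prop. 2.1 (i) / Lawler Prop. 6.5, **proved** in the tree from `HasSLETrace κ` as
  `identDistrib_sleTrace_scale_of_hasSLETrace`, `SLEScaleInvariance.lean`), if a.s.
  `0 ∉ cl γ[1, ∞)` then a.s. `|γ(t)| → ∞`. The law identity is applied to the measurable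
  path-space events `Literature.nearZeroAfter t r` ("`|p(q)| < r` at some rational time `q ≥ t`", which
  for continuous paths is "`|p(s)| < r` at some time `s ≥ t`"), combined with continuity of the
  pre-Wiener probability measure from above and `P[∀ m, ∃ s ≥ m, |γ(s)| < N + 1] ≤
  P[∃ s ≥ c², |γ(s)| < c r₀] = P[∃ s ≥ 1, |γ(s)| < r₀]` for `c = (N+1)(n+1)+1`, `r₀ = 1/(n+1)`.
* `Literature.Probability.RandomPlanarGeometry.tendsto_norm_sleTrace_atTop_of_ne_eight_of_RS05` — **Theorem 7.1 as printed**
  (all `κ ≠ 8`, including `κ = 0`) from exactly three named facts: `hasSLETrace_of_ne_eight`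
  (Thm. 5.1), `RohdeSchramm2005_thm71_simpleStep` and `RohdeSchramm2005_lem73` (SLE scaling being
  proved); `Literature.Probability.RandomPlanarGeometry.tendsto_norm_sleTrace_atTop_of_RS05` — the target fact from these,
  `hasSLETrace_eight` ([LSW] Thm. 4.7) and `RohdeSchramm2005_thm71_eight` (the Update).
* Consistency: `RohdeSchramm2005_thm71_eight` is implied by the target fact
  (`Literature.Probability.RandomPlanarGeometry.RohdeSchramm2005_thm71_eight_of`).

## Mathlib

We USE `ProbabilityTheory.IdentDistrib.measure_mem_eq`, `MeasureTheory.tendsto_measure_iInter_atTop`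
(null-measurable version), `AEMeasurable.nullMeasurableSet_preimage`,
`MeasureTheory.measure_eq_zero_iff_ae_notMem`, `exists_rat_btwn`, `exists_nat_one_div_lt`,
`Filter.tendsto_atTop_atTop`. Mathlib has no SLE / Loewner chains.

## References

* S. Rohde, O. Schramm, *Basic properties of SLE*, Ann. of Math. 161 (2005) 883–924: Lemma 7.2
  (p. 909), Lemma 7.3 (p. 910), Theorem 7.1 and its proof, Update (pp. 909, 911); Lemma 6.6
  (p. 908), Thm. 5.1 (p. 899).
* G. F. Lawler, O. Schramm, W. Werner, *Conformal invariance of planar loop-erased random walks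
  and uniform spanning trees*, Ann. Probab. 32 (2004) 939–995, Thm. 4.7.
* G. F. Lawler, *Conformally Invariant Processes in the Plane*, AMS (2005), Prop. 6.5 (scaling).
-/

noncomputable section

open Set Filter Topology MeasureTheory ProbabilityTheory Metric
open UpperHalfPlane (upperHalfPlaneSet isOpen_upperHalfPlaneSet)
open scoped NNReal

namespace Literature.Probability.RandomPlanarGeometry

/-! ### The named facts (Rohde–Schramm 2005, §7) -/

/-- **Rohde–Schramm (2005), Lemma 7.2** (p. 909). "Suppose that `κ ≤ 4`, and let
`x ∈ ℝ ∖ {0}`. Then a.s. `x ∉ cl γ[0, ∞)`." Here `γ = sleTrace κ ω` is the chordal SLE_κ trace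
on the canonical space and `γ[0, ∞) = range γ`. (Printed proof: a harmonic-measure comparison
reduces to `inf_t Y_{1/2}(t) > 0` for the Bessel-type flow `Y_x(t) = gₜ(x) - ξ(t)`, which follows
from the hitting probabilities of Lemma 6.2 for `κ < 4`; for `κ = 4`, Schwarz reflection, the
Koebe 1/4 theorem and Itô's formula for `log gₜ(x) - log (gₜ(x) - gₜ(y))` with a dilogarithm
correction.) [cite: RohdeSchramm2005, Lemma 7.2] -/
def RohdeSchramm2005_lem72 : Prop :=
  ∀ {κ : ℝ≥0}, κ ≤ 4 → ∀ {x : ℝ}, x ≠ 0 →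
    ∀ᵐ ω ∂Process.preWienerMeasure, (x : ℂ) ∉ closure (range (sleTrace κ ω))

/-- **Rohde–Schramm (2005), proof of Theorem 7.1, case `κ ∈ [0, 4]`** (p. 911), up to and
including the sentence "This means that `0 ∉ cl γ[1, ∞)` a.s.": for `κ ≤ 4`, almost surely the
origin is not in the closure of `γ[1, ∞)`, `γ = sleTrace κ ω`. Printed derivation: "`γ` is a
simple path [Thm. 6.1]. Then a.s. there are two limit points `x₀, x₁` for `g₁(z)` as `z → 0` in
`H₁`. Note that `g₁(γ[1, ∞))` has the same distribution as `γ[0, ∞)` translated by `ξ(1)`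
[conformal Markov property]. Consequently, Lemma 7.2 [`RohdeSchramm2005_lem72`] shows that a.s.
`x₀` and `x₁` are not in the closure of `g₁(γ[1, ∞))`." Vendored as a named fact because the
conformal Markov property of the SLE trace and the prime-end analysis at the base of a slit are
not in the tree. The existence of the path (`HasSLETrace κ`, Thm. 5.1, `hasSLETrace_of_ne_eight`)
is an explicit hypothesis, as in the source where `γ` denotes that path: `sleTrace` is the junk
constant path `0` when the chain is not generated by a curve (`Loewner.trace`), for which
`0 ∈ cl γ[1, ∞)`, so without the hypothesis the almost sure statement would silently assert
Thm. 5.1 for `κ ≤ 4` as well. [cite: RohdeSchramm2005, proof of Thm 7.1 (p. 911)] -/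
def RohdeSchramm2005_thm71_simpleStep : Prop :=
  ∀ {κ : ℝ≥0}, κ ≤ 4 → HasSLETrace κ →
    ∀ᵐ ω ∂Process.preWienerMeasure, (0 : ℂ) ∉ closure (sleTrace κ ω '' Ici 1)

/-- **Rohde–Schramm (2005), Lemma 7.3** (p. 910). "Suppose that `κ > 4`, `κ ≠ 8`, and let
`t > 0`. Then a.s. there is some `ε > 0` such that `Kₜ ⊃ {z ∈ ℍ : |z| < ε}`." Here
`Kₜ = sleHull κ ω t` is the SLE_κ hull. (Printed proof, `κ ∈ (4, 8)`: Thm. 5.1, Lemma 6.6 — an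
interval `[a, b] ⊂ (-∞, 0)` is swallowed all at once with positive probability —, the conformal
Markov property at `τ(1)`, scale invariance and Blumenthal's 0-1 law; `κ > 8`: Thm. 6.4,
Lemma 6.5, the Markov property, Fubini and Cor. 5.3.) [cite: RohdeSchramm2005, Lemma 7.3] -/
def RohdeSchramm2005_lem73 : Prop :=
  ∀ {κ : ℝ≥0}, 4 < κ → κ ≠ 8 → ∀ {t : ℝ≥0}, 0 < t →
    ∀ᵐ ω ∂Process.preWienerMeasure, ∃ ε : ℝ, 0 < ε ∧ {z ∈ upperHalfPlaneSet | ‖z‖ < ε} ⊆ sleHull κ ω t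

/-- **Rohde–Schramm (2005), Theorem 7.1 for `κ = 8`** (Update, p. 911): "Corollary 7.4 and
Theorem 7.1 are true also for `κ = 8`. The proofs are based on the extension [LSW] to `κ = 8` of
Theorem 5.1, and are otherwise the same." Stated as printed, as an implication from that
extension: if SLE₈ is generated by a curve (`HasSLETrace 8`, the named fact `hasSLETrace_eight`,
Lawler–Schramm–Werner (2004), Thm. 4.7), then almost surely `|γ(t)| → ∞` as `t → ∞` for the
SLE₈ trace `γ = sleTrace 8 ω`. Kept as its own named fact: Lemma 7.3 is printed for `κ ≠ 8` only
(its `κ ∈ (4, 8)` branch rests on Lemma 6.6, stated for `κ ∈ (4, 8)`), so the `κ = 8` case is not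
assembled here from printed lemmas. Implied by the target fact `tendsto_norm_sleTrace_atTop`
(`RohdeSchramm2005_thm71_eight_of`). [cite: RohdeSchramm2005, Thm 7.1 and Update (p. 911)] -/
def RohdeSchramm2005_thm71_eight : Prop :=
  HasSLETrace 8 → ∀ᵐ ω ∂Process.preWienerMeasure, Tendsto (fun t ↦ ‖sleTrace 8 ω t‖) atTop atTop

/-- Consistency: the `κ = 8` fact is implied by the target fact `tendsto_norm_sleTrace_atTop`.
[folklore] -/
theorem RohdeSchramm2005_thm71_eight_of (h : tendsto_norm_sleTrace_atTop) :
    RohdeSchramm2005_thm71_eight :=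
  fun _ ↦ h (by norm_num)

/-! ### Deterministic step: a hull containing a half-disc keeps the curve away from `0` -/

namespace Loewner

variable {W : ℝ≥0 → ℝ} {γ : ℝ≥0 → ℂ}

/-- If the hull `Kₜ` contains the half-disc `{z ∈ ℍ : |z| < ε}`, then the generating curve
satisfies `|γ(s)| ≥ ε` for every `s ≥ t`: the curve stays in `cl Hₜ` after time `t`
(`IsGeneratedByCurve.mem_closure_domain`) and `Hₜ = ℍ ∖ Kₜ ⊆ {|z| ≥ ε}`, a closed set. This is
the step "`K₁ ⊃ {z ∈ ℍ : |z| < r}` … implies `|γ(t')| ≥ r` for `t' > 1`" of Rohde–Schramm (2005),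
proof of Thm. 7.1 (p. 911). [cite: RohdeSchramm2005, proof of Thm 7.1 (p. 911)] -/
theorem IsGeneratedByCurve.le_norm_of_subset_hull (hγ : IsGeneratedByCurve W γ)
    (hW : Continuous W) {t : ℝ≥0} {ε : ℝ}
    (hK : {z ∈ upperHalfPlaneSet | ‖z‖ < ε} ⊆ hull W t) {s : ℝ≥0} (hts : t ≤ s) :
    ε ≤ ‖γ s‖ := by
  have hcl : closure (domain W t) ⊆ {z : ℂ | ε ≤ ‖z‖} := by
    refine closure_minimal (fun z hz ↦ ?_) (isClosed_le continuous_const continuous_norm)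
    rw [domain, Set.mem_sdiff] at hz
    by_contra hlt
    rw [mem_setOf_eq, not_le] at hlt
    exact hz.2 (hK ⟨hz.1, hlt⟩)
  exact hcl (hγ.mem_closure_domain hW hts)

end Loewner

/-- **From Lemma 7.3 to `0 ∉ cl γ[1, ∞)`** (`4 < κ ≠ 8`): almost surely the SLE_κ chain is
generated by its trace (`HasSLETrace κ`, hypothesis `hκ`) and `K₁ ⊇ {z ∈ ℍ : |z| < ε}` for some
`ε > 0` (`RohdeSchramm2005_lem73` at `t = 1`, hypothesis `h73`), whence `|γ(s)| ≥ ε` for all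
`s ≥ 1` (`Loewner.IsGeneratedByCurve.le_norm_of_subset_hull`). Rohde–Schramm (2005), proof of
Thm. 7.1, case `κ > 4` (p. 911). [cite: RohdeSchramm2005, proof of Thm 7.1 (p. 911)] -/
theorem ae_zero_notMem_closure_sleTrace_of_lem73 (h73 : RohdeSchramm2005_lem73) {κ : ℝ≥0}
    (hκ : HasSLETrace κ) (h4 : 4 < κ) (h8 : κ ≠ 8) :
    ∀ᵐ ω ∂Process.preWienerMeasure, (0 : ℂ) ∉ closure (sleTrace κ ω '' Ici 1) := by
  filter_upwards [ae_isGeneratedByCurve_sleTrace hκ, h73 h4 h8 (t := 1) one_pos] with ω hω hε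
  obtain ⟨ε, hε, hK⟩ := hε
  rw [Metric.mem_closure_iff]
  push Not
  refine ⟨ε, hε, ?_⟩
  rintro _ ⟨s, hs, rfl⟩
  rw [dist_comm, dist_zero_right]
  exact hω.le_norm_of_subset_hull (continuous_sleDriving κ ω) hK hs

/-! ### Path-space events: coming close to `0` after time `t` -/

section PathEvents

/-- The path-space event "**the path comes within distance `< r` of `0` at some rational time
`q ≥ t`**": `{p : ℝ≥0 → ℂ | ∃ q : ℚ, t ≤ q ∧ |p(q)| < r}`. A countable union of cylinder
events, hence measurable for the product σ-algebra (`measurableSet_nearZeroAfter`); for a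
continuous path it is the event "`|p(s)| < r` for some real `s ≥ t`" (`mem_nearZeroAfter_iff`).
[folklore] -/
def nearZeroAfter (t : ℝ≥0) (r : ℝ) : Set (ℝ≥0 → ℂ) :=
  {p | ∃ q : ℚ, (t : ℝ) ≤ q ∧ ‖p (q : ℝ).toNNReal‖ < r}

/-- `nearZeroAfter t r` is measurable (product σ-algebra on `ℝ≥0 → ℂ`). [folklore] -/
theorem measurableSet_nearZeroAfter (t : ℝ≥0) (r : ℝ) : MeasurableSet (nearZeroAfter t r) := by
  have h : nearZeroAfter t r =
      ⋃ q : ℚ, {p : ℝ≥0 → ℂ | (t : ℝ) ≤ q} ∩ {p | ‖p (q : ℝ).toNNReal‖ < r} := by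
    ext p
    simp only [nearZeroAfter, mem_setOf_eq, mem_iUnion, mem_inter_iff]
  rw [h]
  exact MeasurableSet.iUnion fun q ↦ (MeasurableSet.const _).inter
    (measurableSet_lt (measurable_pi_apply _).norm measurable_const)

/-- `nearZeroAfter t r` increases with `r`. [folklore] -/
theorem nearZeroAfter_mono (t : ℝ≥0) {r r' : ℝ} (h : r ≤ r') :
    nearZeroAfter t r ⊆ nearZeroAfter t r' :=
  fun _ ⟨q, hq, hlt⟩ ↦ ⟨q, hq, hlt.trans_le h⟩

/-- `nearZeroAfter t r` decreases with `t`. [folklore] -/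
theorem nearZeroAfter_anti {t t' : ℝ≥0} (h : t ≤ t') (r : ℝ) :
    nearZeroAfter t' r ⊆ nearZeroAfter t r :=
  fun _ ⟨q, hq, hlt⟩ ↦ ⟨q, (NNReal.coe_le_coe.2 h).trans hq, hlt⟩

/-- For a **continuous** path, `p ∈ nearZeroAfter t r` iff `|p(s)| < r` for some real time
`s ≥ t` (rational times are dense and `{s | |p(s)| < r}` is open). [folklore] -/
theorem mem_nearZeroAfter_iff {p : ℝ≥0 → ℂ} (hp : Continuous p) {t : ℝ≥0} {r : ℝ} :
    p ∈ nearZeroAfter t r ↔ ∃ s : ℝ≥0, t ≤ s ∧ ‖p s‖ < r := by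
  constructor
  · rintro ⟨q, hq, hlt⟩
    refine ⟨(q : ℝ).toNNReal, ?_, hlt⟩
    exact (Real.le_toNNReal_iff_coe_le (t.2.trans hq)).2 hq
  · rintro ⟨s, hts, hlt⟩
    have ho : IsOpen {u : ℝ≥0 | ‖p u‖ < r} := isOpen_lt hp.norm continuous_const
    obtain ⟨δ, hδ, hball⟩ := Metric.isOpen_iff.1 ho s hlt
    obtain ⟨q, hsq, hqs⟩ := exists_rat_btwn (show (s : ℝ) < s + δ by linarith)
    have hq0 : (0 : ℝ) ≤ q := s.2.trans hsq.le
    refine ⟨q, (NNReal.coe_le_coe.2 hts).trans hsq.le, hball ?_⟩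
    rw [Metric.mem_ball, NNReal.dist_eq, Real.coe_toNNReal _ hq0, abs_sub_lt_iff]
    constructor <;> linarith

/-- **Scaling of the events.** For a continuous path `p` and `c > 0`, the rescaled path
`s ↦ c p(s / c²)` comes within `c r` of `0` after time `c² t` iff `p` comes within `r` of `0`
after time `t`. [folklore] -/
theorem scale_mem_nearZeroAfter_iff {p : ℝ≥0 → ℂ} (hp : Continuous p) {c : ℝ≥0} (hc : c ≠ 0)
    {t : ℝ≥0} {r : ℝ} :
    (fun s ↦ (c : ℂ) * p (s / c ^ 2)) ∈ nearZeroAfter (c ^ 2 * t) (c * r) ↔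
      p ∈ nearZeroAfter t r := by
  have hc' : (0 : ℝ) < c := NNReal.coe_pos.2 (pos_iff_ne_zero.2 hc)
  have hc2 : c ^ 2 ≠ 0 := pow_ne_zero 2 hc
  have hcont : Continuous fun s : ℝ≥0 ↦ (c : ℂ) * p (s / c ^ 2) :=
    continuous_const.mul (hp.comp (continuous_id.div_const _))
  rw [mem_nearZeroAfter_iff hcont, mem_nearZeroAfter_iff hp]
  have hnorm : ∀ z : ℂ, ‖(c : ℂ) * z‖ < c * r ↔ ‖z‖ < r := fun z ↦ by
    rw [norm_mul, Complex.norm_of_nonneg hc'.le]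
    exact mul_lt_mul_iff_of_pos_left hc'
  constructor
  · rintro ⟨s, hts, hlt⟩
    refine ⟨s / c ^ 2, ?_, (hnorm _).1 hlt⟩
    rwa [le_div_iff₀ (pos_iff_ne_zero.2 hc2), mul_comm]
  · rintro ⟨u, htu, hlt⟩
    refine ⟨c ^ 2 * u, mul_le_mul_right htu _, ?_⟩
    rwa [mul_div_cancel_left₀ _ hc2, hnorm]

end PathEvents

/-! ### The scaling step of the proof of Theorem 7.1 -/

/-- **Rohde–Schramm (2005), proof of Theorem 7.1, final step** ("The proof is then completed as
in the case `κ > 4` above", p. 911), proved: let SLE_κ be a.s. generated by a curve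
(`HasSLETrace κ`, hypothesis `hκ`) and suppose that a.s. `0 ∉ cl γ[1, ∞)` (hypothesis `h1`;
for `κ > 4` this is Lemma 7.3, for `κ ≤ 4` the simple-path step). Then a.s. `|γ(t)| → ∞`.
Proof as printed, in the language of the trace: a.s. there is a random `r > 0` with
`|γ(s)| ≥ r` for `s ≥ 1`; by continuity from above of the pre-Wiener probability measure,
`P[∃ s ≥ 1, |γ(s)| < r₀] < ε` for `r₀ = 1/(n+1)` small; by scale invariance in law of the trace
(hypothesis `hscale`: `γ ~ c γ(·/c²)` on the path space, the `κ`-instance of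
`identDistrib_sleTrace_scale`, proved from `HasSLETrace κ` as
`identDistrib_sleTrace_scale_of_hasSLETrace`) applied to the measurable events `nearZeroAfter`,
`P[∃ s ≥ c², |γ(s)| < c r₀] = P[∃ s ≥ 1, |γ(s)| < r₀] < ε` for every `c > 0`; hence
`P[∀ m, ∃ s ≥ m, |γ(s)| < N + 1] < ε` for every `ε`, i.e. `= 0`, for every `N`, which is
transience. The pre-Wiener measure is a probability measure by the proved Kolmogorov extension
theorem (`exists_isProjectiveLimit_holds`). [cite: RohdeSchramm2005, proof of Thm 7.1 (p. 911)] -/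
theorem tendsto_norm_sleTrace_atTop_of_notMem_closure {κ : ℝ≥0} (hκ : HasSLETrace κ)
    (hscale : ∀ {c : ℝ≥0}, c ≠ 0 →
      IdentDistrib (fun ω ↦ sleTrace κ ω) (fun ω t ↦ (c : ℂ) * sleTrace κ ω (t / c ^ 2))
        Process.preWienerMeasure Process.preWienerMeasure)
    (h1 : ∀ᵐ ω ∂Process.preWienerMeasure, (0 : ℂ) ∉ closure (sleTrace κ ω '' Ici 1)) :
    ∀ᵐ ω ∂Process.preWienerMeasure, Tendsto (fun t ↦ ‖sleTrace κ ω t‖) atTop atTop := by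
  haveI : IsProbabilityMeasure Process.preWienerMeasure := Process.isProbabilityMeasure_preWienerMeasure
    (Process.isProjectiveLimit_preWienerMeasure_of Process.exists_isProjectiveLimit_holds)
  set μ : Measure (ℝ≥0 → ℝ) := Process.preWienerMeasure with hμ
  set Φ : (ℝ≥0 → ℝ) → ℝ≥0 → ℂ := fun ω ↦ sleTrace κ ω with hΦ_def
  have hΦ : AEMeasurable Φ μ := (hscale one_ne_zero).aemeasurable_fst
  have hcont : ∀ᵐ ω ∂μ, Continuous (Φ ω) := by
    filter_upwards [ae_isGeneratedByCurve_sleTrace hκ] with ω hω using hω.continuous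
  -- the events `A n = {∃ s ≥ 1, |γ(s)| < 1/(n+1)}` decrease to a null event
  set A : ℕ → Set (ℝ≥0 → ℝ) := fun n ↦ Φ ⁻¹' nearZeroAfter 1 (1 / ((n : ℝ) + 1)) with hA_def
  have hA_null : ∀ n, NullMeasurableSet (A n) μ := fun n ↦
    hΦ.nullMeasurableSet_preimage (measurableSet_nearZeroAfter _ _)
  have hA_anti : Antitone A := by
    intro m n hmn
    refine preimage_mono (nearZeroAfter_mono 1 ?_)
    have hm1 : (0 : ℝ) < (m : ℝ) + 1 := by positivity
    exact one_div_le_one_div_of_le hm1 (by exact_mod_cast Nat.add_le_add_right hmn 1)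
  have hA_inter : μ (⋂ n, A n) = 0 := by
    rw [measure_eq_zero_iff_ae_notMem]
    filter_upwards [h1] with ω hω hmem
    rw [Metric.mem_closure_iff] at hω
    push Not at hω
    obtain ⟨ε, hε, hfar⟩ := hω
    obtain ⟨n, hn⟩ := exists_nat_one_div_lt hε
    obtain ⟨q, hq, hlt⟩ := (mem_iInter.1 hmem) n
    have hq1 : (1 : ℝ≥0) ≤ (q : ℝ).toNNReal :=
      (Real.le_toNNReal_iff_coe_le (zero_le_one.trans hq)).2 hq
    have hfar' := hfar _ (mem_image_of_mem _ (mem_Ici.2 hq1))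
    rw [dist_comm, dist_zero_right] at hfar'
    exact absurd (hlt.trans hn) (not_lt.2 hfar')
  have hA_tendsto : Tendsto (fun n ↦ μ (A n)) atTop (𝓝 0) := by
    have h := tendsto_measure_iInter_atTop hA_null hA_anti ⟨0, measure_ne_top μ _⟩
    rwa [hA_inter] at h
  -- the events `X N = {∀ m, ∃ s ≥ m, |γ(s)| < N + 1}` are null, by scaling
  have hX : ∀ N : ℕ, μ (⋂ m : ℕ, Φ ⁻¹' nearZeroAfter (m : ℝ≥0) ((N : ℝ) + 1)) = 0 := by
    intro N
    refine le_antisymm (ge_of_tendsto' hA_tendsto fun n ↦ ?_) zero_le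
    -- scale `c = (N+1)(n+1)+1`, time `c²`, radius `c/(n+1) ≥ N+1`
    set k : ℕ := (N + 1) * (n + 1) + 1 with hk
    set c : ℝ≥0 := (k : ℝ≥0) with hc_def
    have hk0 : k ≠ 0 := by omega
    have hc0 : c ≠ 0 := by rw [hc_def]; exact_mod_cast hk0
    have hcR : (c : ℝ) = ((N : ℝ) + 1) * ((n : ℝ) + 1) + 1 := by
      rw [hc_def, NNReal.coe_natCast, hk]; push_cast; ring
    have hn1 : (0 : ℝ) < (n : ℝ) + 1 := by positivity
    have hrad : (N : ℝ) + 1 ≤ (c : ℝ) * (1 / ((n : ℝ) + 1)) := by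
      rw [hcR, mul_one_div, le_div_iff₀ hn1]
      linarith
    have htime : c ^ 2 * 1 ≤ ((k ^ 2 : ℕ) : ℝ≥0) := by
      rw [mul_one, hc_def, Nat.cast_pow]
    calc μ (⋂ m : ℕ, Φ ⁻¹' nearZeroAfter (m : ℝ≥0) ((N : ℝ) + 1))
        ≤ μ (Φ ⁻¹' nearZeroAfter ((k ^ 2 : ℕ) : ℝ≥0) ((N : ℝ) + 1)) :=
          measure_mono (iInter_subset _ (k ^ 2))
      _ ≤ μ (Φ ⁻¹' nearZeroAfter (c ^ 2 * 1) ((c : ℝ) * (1 / ((n : ℝ) + 1)))) :=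
          measure_mono (preimage_mono
            ((nearZeroAfter_anti htime _).trans (nearZeroAfter_mono _ hrad)))
      _ = μ ((fun ω t ↦ (c : ℂ) * sleTrace κ ω (t / c ^ 2)) ⁻¹'
            nearZeroAfter (c ^ 2 * 1) ((c : ℝ) * (1 / ((n : ℝ) + 1)))) :=
          (hscale hc0).measure_mem_eq (measurableSet_nearZeroAfter _ _)
      _ = μ (A n) := by
          refine measure_congr ?_
          filter_upwards [hcont] with ω hω
          exact propext (scale_mem_nearZeroAfter_iff hω hc0)
  -- conclusion
  have hae : ∀ᵐ ω ∂μ, ∀ N : ℕ, ω ∉ ⋂ m : ℕ, Φ ⁻¹' nearZeroAfter (m : ℝ≥0) ((N : ℝ) + 1) := by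
    rw [ae_all_iff]
    exact fun N ↦ measure_eq_zero_iff_ae_notMem.1 (hX N)
  filter_upwards [hae, hcont] with ω hN hc
  rw [tendsto_atTop_atTop]
  intro R
  obtain ⟨N, hNR⟩ := exists_nat_gt R
  have hN' := hN N
  rw [mem_iInter, not_forall] at hN'
  obtain ⟨m, hm⟩ := hN'
  rw [mem_preimage, mem_nearZeroAfter_iff hc, not_exists] at hm
  refine ⟨m, fun s hs ↦ ?_⟩
  have hms := hm s
  rw [not_and, not_lt] at hms
  have := hms hs
  change (N : ℝ) + 1 ≤ ‖sleTrace κ ω s‖ at this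
  linarith

/-! ### Assembly: Theorem 7.1 from the named facts -/

/-- **Rohde–Schramm (2005), Theorem 7.1, as printed** ("for all `κ ≠ 8` the SLE_κ trace is
transient a.s."), from exactly three named facts along the printed proof: the trace exists
(`hasSLETrace_of_ne_eight`, Thm. 5.1; hypothesis `hne`), and `0 ∉ cl γ[1, ∞)` a.s. — for
`κ ≤ 4` the simple-path step (`RohdeSchramm2005_thm71_simpleStep`; `hle`), for `κ > 4` Lemma 7.3
(`RohdeSchramm2005_lem73`; `h73`). The scaling property of SLE used in the last step
(`tendsto_norm_sleTrace_atTop_of_notMem_closure`, proved) is the proved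
`identDistrib_sleTrace_scale_of_hasSLETrace` (Brownian scaling, Loewner scaling, uniqueness of
the generating curve, measurability of the trace functional). [cite: RohdeSchramm2005, Thm 7.1] -/
theorem tendsto_norm_sleTrace_atTop_of_ne_eight_of_RS05 (hne : hasSLETrace_of_ne_eight)
    (hle : RohdeSchramm2005_thm71_simpleStep) (h73 : RohdeSchramm2005_lem73) {κ : ℝ≥0}
    (h8 : κ ≠ 8) :
    ∀ᵐ ω ∂Process.preWienerMeasure, Tendsto (fun t ↦ ‖sleTrace κ ω t‖) atTop atTop := by
  have hκ : HasSLETrace κ := hne h8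
  refine tendsto_norm_sleTrace_atTop_of_notMem_closure hκ
    (fun hc ↦ identDistrib_sleTrace_scale_of_hasSLETrace hκ hc) ?_
  rcases le_or_gt κ 4 with h4 | h4
  · exact hle h4 hκ
  · exact ae_zero_notMem_closure_sleTrace_of_lem73 h73 hκ h4 h8

/-- **The target fact `tendsto_norm_sleTrace_atTop` from the Rohde–Schramm inputs**: Theorem 7.1
for `κ ≠ 8` (`tendsto_norm_sleTrace_atTop_of_ne_eight_of_RS05`, from Thm. 5.1, the simple-path
step and Lemma 7.3; `hne`, `hle`, `h73`) and, for `κ = 8`, the Update (`RohdeSchramm2005_thm71_eight`;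
`h8`) applied to the extension of Thm. 5.1 to `κ = 8` (`hasSLETrace_eight`, Lawler–Schramm–Werner
(2004), Thm. 4.7; `h8e`). [cite: RohdeSchramm2005, Thm 7.1 and Update (p. 911)] -/
theorem tendsto_norm_sleTrace_atTop_of_RS05 (hne : hasSLETrace_of_ne_eight)
    (h8e : hasSLETrace_eight) (hle : RohdeSchramm2005_thm71_simpleStep)
    (h73 : RohdeSchramm2005_lem73) (h8 : RohdeSchramm2005_thm71_eight) :
    tendsto_norm_sleTrace_atTop := by
  intro κ _
  rcases eq_or_ne κ 8 with rfl | hκ8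
  · exact h8 h8e
  · exact tendsto_norm_sleTrace_atTop_of_ne_eight_of_RS05 hne hle h73 hκ8

end Literature.Probability.RandomPlanarGeometry

end
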